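import Mathlib
import HarnessLib.Audit
import Summits.PneNP.PneNP.Theorems.PstarGateNodesX
import Summits.PneNP.PneNP.Theorems.PstarGateFibreRank
import Summits.PneNP.PneNP.Theorems.PstarGateCasePNorHolders

/-!
# One GATED chord, node N6 (closed core): the SHARING BUDGET of the single gated cycle (E2; prover-1 g19)

FRONTIER range-avoidance ladder, rung F-N3 (`stmt-PneNP-19007`), cell `pnp-ideate` (`PstarGateNodesX.GateUnitCycleQuadX`; this seat's NOTES
`## N6X architecture`); restricted-model proof complexity — nothing here bears on `P` versus `NP`.

`N = {e}`: the core is the cycle `D e + e` (`J₀_eq_of_single`).  `(r, 3/2)`-boundary expansion of the family `X = D e + e + g₀` (the cycle and the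
gate `g₀ = (p, u)`): XOR slots of cycle edges are inner (`xor_not_mem_bdry_of_even`), `p` is held by `e` and `g₀`, `u` by `g₀` and the star of
`u` in `D e`, so `g₀` pays at most its two XOR variables, `e` at most `p'`, an edge of `D e` through `u` at most one variable, and an edge of
`D e` avoiding `u` at most two — at most ONE unless it is PRIVATE in `X` (both AND variables held by no other member).  Hence

* `budget` — **`#star(u) + 2·#(non-private avoiding edges) ≤ #avoid(D e, u)`** (and the star is non-empty);
* `card_le_five_of_avoid_le_two` — **if at most two edges of `D e` avoid `u` then `#J₀ ≤ 5`**;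
* `exists_private_of_three_le` — **if at least three edges avoid `u`, two of them are private in `X` (and a third exists)** — the input of the
  rank-six step of node N6 (three avoiding edges, two of them private, give `Q_{D e}` rank `≥ 6` on the gate chamber).
-/

set_option linter.dupNamespace false -- `Summit.PneNP.PneNP.…`: summit = sub-problem name (D-0017 single-conjunct layout)

open Finset Literature.Computability.Complexity
open Summit.PneNP.PneNP.Theorems.PstarTyped (Typed)
open Summit.PneNP.PneNP.Theorems.PstarSALevel (varSet bdry BoundaryExpanding SimpleOverlap)
open Summit.PneNP.PneNP.Theorems.PstarCentreFree (vars_mem_varSet)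
open Summit.PneNP.PneNP.Theorems.PstarCoreBound (XorClosed)
open Summit.PneNP.PneNP.Theorems.PstarPathRankFibre (avoid)
open Summit.PneNP.PneNP.Theorems.PstarChordBridgeTools (xpdeg)
open Summit.PneNP.PneNP.Theorems.PstarChordBridge (BridgeData)
open Summit.PneNP.PneNP.Theorems.PstarChordBridgeCotree (Peelable)
open Summit.PneNP.PneNP.Theorems.PstarNorUnitRegime (J₀_eq_of_single)
open Summit.PneNP.PneNP.Theorems.PstarNorCoreTools (not_mem_bdry_of_two card_varSet_inter_bdry_le card_bdry_le_sum)
open Summit.PneNP.PneNP.Theorems.PstarNorUnitBridge (xor_not_mem_bdry_of_even)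
open Summit.PneNP.PneNP.Theorems.PstarGateBridge (GateHyp)
open Summit.PneNP.PneNP.Theorems.PstarGateFibreRank (card_through_add_card_avoid)
open Summit.PneNP.PneNP.Theorems.PstarGateCasePNorHolders (not_mem_bdry_sup card_three_slots)
open Summit.PneNP.PneNP.Theorems.PstarGateNodes (GateData)
open Summit.PneNP.PneNP.Theorems.PstarGateNodesX (GateDataX)

namespace Summit.PneNP.PneNP.Theorems.PstarGateUnitCycleBudget

variable {n m : ℕ}

/-- **The sharing budget of the single gated cycle.**  One-gate bridge data on an XOR-closed core with `N = {e}`: for some set `Pv` of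
`u`-avoiding edges of `D e`, each private in `X = D e + e + g₀`, `#star(u) + 2·#(avoid ∖ Pv) ≤ #avoid`, and the star of `u` is non-empty. -/
theorem budget (I : LocalMap 4 n m) (hI : I.IsPure xorAndPred) (hT : Typed I) {r : ℕ}
    (hB : BoundaryExpanding r I) {B : BridgeData n m} {e g₀ : Fin m} {u : Fin n} {κ₀ : ZMod 2} (hD : GateDataX I r B e g₀ u κ₀)
    (hN : B.N = {e}) :
    ∃ Pv ⊆ avoid I (B.D e) {u},
      (∀ j ∈ Pv, ∀ j' ∈ insert g₀ (insert e (B.D e)), j' ≠ j → I.vars j 2 ∉ varSet I j' ∧ I.vars j 3 ∉ varSet I j') ∧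
      ((B.D e).filter fun j => I.vars j 2 = u ∨ I.vars j 3 = u).card + 2 * (avoid I (B.D e) {u} \ Pv).card ≤ (avoid I (B.D e) {u}).card ∧
      1 ≤ ((B.D e).filter fun j => I.vars j 2 = u ∨ I.vars j 3 = u).card := by
  classical
  obtain ⟨hXc, hW, hr, hd₁, -, -, hPe, -, hG, hg₀, hgv, hju, -⟩ := id hD
  set D := B.D e with hDdef
  set T := D.filter (fun j => I.vars j 2 = u ∨ I.vars j 3 = u) with hTdef
  set A := avoid I D {u} with hAdef
  set X : Finset (Fin m) := insert g₀ (insert e D) with hXdef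
  set Pv := A.filter (fun j => ∀ j' ∈ X, j' ≠ j → I.vars j 2 ∉ varSet I j' ∧ I.vars j 3 ∉ varSet I j') with hPv
  have he : e ∈ B.N := by rw [hN]; exact mem_singleton_self _
  have hg₀J : g₀ ∉ B.J₀ := fun h => disjoint_left.1 hd₁ hg₀ h
  have heD : e ∉ D := fun h => (mem_sdiff.1 (hW.hD e he h)).2 he
  have hJ : B.J₀ = insert e D := J₀_eq_of_single I hI hT hW hXc hPe hN
  have hAD : A ⊆ D := filter_subset _ _
  have hTD : T ⊆ D := filter_subset _ _
  -- the star through `u` is non-empty: `u` is an AND input of a tree edge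
  obtain ⟨jᵤ, hjᵤD, hjᵤu⟩ : ∃ jᵤ ∈ D, I.vars jᵤ 2 = u ∨ I.vars jᵤ 3 = u := by
    obtain ⟨j₀, hj₀, hju'⟩ := hju
    have hj₀D : j₀ ∈ D := by
      have h := (mem_sdiff.1 hj₀).1
      rw [hJ, mem_insert] at h
      rcases h with h | h
      · exact absurd (h ▸ he) (mem_sdiff.1 hj₀).2
      · exact h
    refine ⟨j₀, hj₀D, ?_⟩
    rcases hju' with h | h
    · exact Or.inl h.symm
    · exact Or.inr h.symm
  have hjᵤT : jᵤ ∈ T := mem_filter.2 ⟨hjᵤD, hjᵤu⟩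
  have hT1 : 1 ≤ T.card := card_pos.2 ⟨jᵤ, hjᵤT⟩
  refine ⟨Pv, filter_subset _ _, fun j hj => (mem_filter.1 hj).2, ?_, hT1⟩
  -- membership bookkeeping in `X`
  have hg₀X' : g₀ ∉ insert e D := fun h => hg₀J (by rw [hJ]; exact h)
  have hXcard : X.card = D.card + 2 := by
    rw [hXdef, card_insert_of_notMem hg₀X', card_insert_of_notMem heD]
  have hXr : X.card ≤ r := by
    refine le_trans (card_le_card ?_) hr
    rw [hXdef]
    refine insert_subset (mem_union_left _ (mem_union_right _ hg₀)) ?_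
    rw [← hJ]; exact subset_union_left.trans subset_union_left
  have hg₀X : g₀ ∈ X := mem_insert_self _ _
  have hsubX : insert e D ⊆ X := subset_insert _ _
  have heX : e ∈ X := hsubX (mem_insert_self _ _)
  have hDX : ∀ {j}, j ∈ D → j ∈ X := fun hj => hsubX (mem_insert_of_mem hj)
  have hjᵤX : jᵤ ∈ X := hDX hjᵤD
  have hg₀e : g₀ ≠ e := fun h => hg₀X' (h ▸ mem_insert_self _ _)
  have hg₀D : ∀ {j}, j ∈ D → j ≠ g₀ := fun hj h => hg₀X' (h ▸ mem_insert_of_mem hj)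
  have heD' : ∀ {j}, j ∈ D → j ≠ e := fun hj h => heD (h ▸ hj)
  -- inner variables: XOR slots of the cycle; `p` (in `e` and `g₀`); `u` (in `g₀` and `jᵤ`)
  have heven : ∀ w, Even (xpdeg I (insert e D) w) := hW.hDeven e he
  have hxor : ∀ j ∈ insert e D, ∀ s : Fin 4, s.val < 2 → I.vars j s ∉ bdry I X := fun j hj s hs =>
    not_mem_bdry_sup I hsubX hj (vars_mem_varSet I j s) (xor_not_mem_bdry_of_even I hI heven j hj s hs)
  have hp_g₀ : I.vars e 2 ∈ varSet I g₀ := by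
    rcases hgv with ⟨h2, -⟩ | ⟨-, h3⟩
    · exact h2 ▸ vars_mem_varSet I g₀ 2
    · exact h3 ▸ vars_mem_varSet I g₀ 3
  have hu_jᵤ : u ∈ varSet I jᵤ := by
    rcases hjᵤu with h | h
    · exact h ▸ vars_mem_varSet I jᵤ 2
    · exact h ▸ vars_mem_varSet I jᵤ 3
  -- per-output budgets
  let q : Fin m → ℕ := fun j => if j = g₀ then 2 else if j = e then 1 else if j ∈ T ∪ (A \ Pv) then 1 else 2
  have hq : ∀ j ∈ X, (varSet I j ∩ bdry I X).card ≤ q j := by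
    intro j hj
    by_cases hjg : j = g₀
    · -- the gate: both AND slots held inside
      subst hjg
      simp only [q, if_true]
      have h := card_varSet_inter_bdry_le I X j {2, 3} (fun s hs => by
        simp only [mem_insert, mem_singleton] at hs
        rcases hs with rfl | rfl
        · rcases hgv with ⟨h2, -⟩ | ⟨h2, -⟩
          · exact not_mem_bdry_of_two I hj heX hg₀e (vars_mem_varSet I j 2) (h2 ▸ vars_mem_varSet I e 2)
          · exact not_mem_bdry_of_two I hj hjᵤX (hg₀D hjᵤD).symm (vars_mem_varSet I j 2) (h2 ▸ hu_jᵤ)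
        · rcases hgv with ⟨-, h3⟩ | ⟨-, h3⟩
          · exact not_mem_bdry_of_two I hj hjᵤX (hg₀D hjᵤD).symm (vars_mem_varSet I j 3) (h3 ▸ hu_jᵤ)
          · exact not_mem_bdry_of_two I hj heX hg₀e (vars_mem_varSet I j 3) (h3 ▸ vars_mem_varSet I e 2))
      have h2 : ({2, 3} : Finset (Fin 4)).card = 2 := by decide
      rw [h2] at h
      exact h
    by_cases hje : j = e
    · -- the gated chord: XOR slots inner, `p` held by `g₀`
      subst hje
      simp only [q, if_neg hjg, if_true]
      have h := card_varSet_inter_bdry_le I X j {0, 1, 2} (fun s hs => by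
        simp only [mem_insert, mem_singleton] at hs
        rcases hs with rfl | rfl | rfl
        · exact hxor j (mem_insert_self _ _) 0 (by decide)
        · exact hxor j (mem_insert_self _ _) 1 (by decide)
        · exact not_mem_bdry_of_two I hj hg₀X hg₀e.symm (vars_mem_varSet I j 2) hp_g₀)
      have h3 : ({0, 1, 2} : Finset (Fin 4)).card = 3 := by decide
      rw [h3] at h
      exact h
    -- an edge of `D e`
    have hjD : j ∈ D := by
      rw [hXdef, mem_insert, mem_insert] at hj
      rcases hj with h | h | h
      · exact absurd h hjg
      · exact absurd h hje
      · exact h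
    simp only [q, if_neg hjg, if_neg hje]
    by_cases hjS : j ∈ T ∪ (A \ Pv)
    · rw [if_pos hjS]
      -- some AND slot of `j` is held by another member of `X`
      obtain ⟨s, hs2, j', hj', hne, hv⟩ : ∃ s : Fin 4, 2 ≤ s.val ∧ ∃ j' ∈ X, j' ≠ j ∧ I.vars j s ∈ varSet I j' := by
        rcases mem_union.1 hjS with hjT | hjA
        · rcases (mem_filter.1 hjT).2 with h | h
          · exact ⟨2, by decide, g₀, hg₀X, (hg₀D hjD).symm, by
              rw [h]; rcases hgv with ⟨-, h3⟩ | ⟨h2, -⟩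
              · exact h3 ▸ vars_mem_varSet I g₀ 3
              · exact h2 ▸ vars_mem_varSet I g₀ 2⟩
          · exact ⟨3, by decide, g₀, hg₀X, (hg₀D hjD).symm, by
              rw [h]; rcases hgv with ⟨-, h3⟩ | ⟨h2, -⟩
              · exact h3 ▸ vars_mem_varSet I g₀ 3
              · exact h2 ▸ vars_mem_varSet I g₀ 2⟩
        · obtain ⟨hjA', hjPv⟩ := mem_sdiff.1 hjA
          have hnp : ¬ ∀ j' ∈ X, j' ≠ j → I.vars j 2 ∉ varSet I j' ∧ I.vars j 3 ∉ varSet I j' := fun h => hjPv (mem_filter.2 ⟨hjA', h⟩)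
          push Not at hnp
          obtain ⟨j', hj', hne, hv⟩ := hnp
          by_cases h2 : I.vars j 2 ∈ varSet I j'
          · exact ⟨2, by decide, j', hj', hne, h2⟩
          · exact ⟨3, by decide, j', hj', hne, hv h2⟩
      have h := card_varSet_inter_bdry_le I X j {0, 1, s} (fun s' hs' => by
        simp only [mem_insert, mem_singleton] at hs'
        rcases hs' with rfl | rfl | rfl
        · exact hxor j (mem_insert_of_mem hjD) 0 (by decide)
        · exact hxor j (mem_insert_of_mem hjD) 1 (by decide)
        · exact not_mem_bdry_of_two I hj hj' (Ne.symm hne) (vars_mem_varSet I j s') hv)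
      rw [card_three_slots hs2] at h
      exact h
    · rw [if_neg hjS]
      have h := card_varSet_inter_bdry_le I X j {0, 1} (fun s' hs' => by
        simp only [mem_insert, mem_singleton] at hs'
        rcases hs' with rfl | rfl
        · exact hxor j (mem_insert_of_mem hjD) 0 (by decide)
        · exact hxor j (mem_insert_of_mem hjD) 1 (by decide))
      have h2 : ({0, 1} : Finset (Fin 4)).card = 2 := by decide
      rw [h2] at h
      exact h
  have hbd := card_bdry_le_sum I X q hq
  -- evaluate the sum
  set S := T ∪ (A \ Pv) with hSdef
  have hSD : S ⊆ D := union_subset hTD (sdiff_subset.trans hAD)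
  have hTA : Disjoint T A := by
    rw [hTdef, hAdef]
    unfold PstarPathRankFibre.avoid
    rw [disjoint_filter]
    intro j _ h
    simp only [mem_singleton, not_and, not_not]
    intro h2
    rcases h with h | h
    · exact absurd h h2
    · exact h
  have hScard : S.card = T.card + (A \ Pv).card := by
    rw [hSdef, card_union_of_disjoint (hTA.mono_right sdiff_subset)]
  have hqD : ∀ j ∈ D, q j = if j ∈ S then 1 else 2 := by
    intro j hj
    simp only [q, if_neg (hg₀D hj), if_neg (heD' hj), hSdef]
  have hsumD : ∑ j ∈ D, q j + S.card = 2 * D.card := by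
    rw [sum_congr rfl hqD, sum_ite, sum_const, sum_const, smul_eq_mul, smul_eq_mul, mul_one]
    have h1 : D.filter (fun j => j ∈ S) = S := by
      ext j
      rw [mem_filter]
      exact ⟨fun h => h.2, fun h => ⟨hSD h, h⟩⟩
    have h2 : (D.filter (fun j => ¬ j ∈ S)).card = D.card - S.card := by
      have := card_filter_add_card_filter_not (s := D) (fun j => j ∈ S)
      rw [h1] at this
      omega
    rw [h1, h2]
    have := card_le_card hSD
    omega
  have hsumX : ∑ j ∈ X, q j = 3 + ∑ j ∈ D, q j := by
    rw [hXdef, sum_insert hg₀X', sum_insert heD]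
    simp only [q, if_true, if_neg hg₀e.symm]
    ring
  have hexp := hB X hXr
  rw [hXcard] at hexp
  rw [hsumX] at hbd
  have hsplit : T.card + A.card = D.card := by rw [hTdef, hAdef]; exact card_through_add_card_avoid I D u
  omega

/-- **At most two avoiding edges ⟹ `#J₀ ≤ 5`.** -/
theorem card_le_five_of_avoid_le_two (I : LocalMap 4 n m) (hI : I.IsPure xorAndPred) (hT : Typed I) {r : ℕ}
    (hB : BoundaryExpanding r I) {B : BridgeData n m} {e g₀ : Fin m} {u : Fin n} {κ₀ : ZMod 2} (hD : GateDataX I r B e g₀ u κ₀)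
    (hN : B.N = {e}) (h2 : (avoid I (B.D e) {u}).card ≤ 2) : B.J₀.card ≤ 5 := by
  classical
  obtain ⟨hXc, hW, -, -, -, -, hPe, -⟩ := id hD
  obtain ⟨Pv, -, -, hle, -⟩ := budget I hI hT hB hD hN
  have he : e ∈ B.N := by rw [hN]; exact mem_singleton_self _
  have heD : e ∉ B.D e := fun h => (mem_sdiff.1 (hW.hD e he h)).2 he
  have hsplit := card_through_add_card_avoid I (B.D e) u
  rw [J₀_eq_of_single I hI hT hW hXc hPe hN, card_insert_of_notMem heD]
  omega

/-- **At least three avoiding edges ⟹ two of them are private in `D e + e + g₀`, and a third one exists.** -/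
theorem exists_private_of_three_le (I : LocalMap 4 n m) (hI : I.IsPure xorAndPred) (hT : Typed I) {r : ℕ}
    (hB : BoundaryExpanding r I) {B : BridgeData n m} {e g₀ : Fin m} {u : Fin n} {κ₀ : ZMod 2} (hD : GateDataX I r B e g₀ u κ₀)
    (hN : B.N = {e}) (h3 : 3 ≤ (avoid I (B.D e) {u}).card) :
    ∃ j₁ ∈ avoid I (B.D e) {u}, ∃ j₂ ∈ avoid I (B.D e) {u}, ∃ j₃ ∈ avoid I (B.D e) {u}, j₁ ≠ j₂ ∧ j₁ ≠ j₃ ∧ j₂ ≠ j₃ ∧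
      (∀ j' ∈ insert g₀ (insert e (B.D e)), j' ≠ j₁ → I.vars j₁ 2 ∉ varSet I j' ∧ I.vars j₁ 3 ∉ varSet I j') ∧
      (∀ j' ∈ insert g₀ (insert e (B.D e)), j' ≠ j₂ → I.vars j₂ 2 ∉ varSet I j' ∧ I.vars j₂ 3 ∉ varSet I j') := by
  classical
  obtain ⟨Pv, hPv, hpriv, hle, hT1⟩ := budget I hI hT hB hD hN
  set A := avoid I (B.D e) {u} with hAdef
  have hcard : (A \ Pv).card + Pv.card = A.card := by
    rw [card_sdiff_add_card_eq_card hPv]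
  have hPv2 : 1 < Pv.card := by omega
  obtain ⟨j₁, hj₁, j₂, hj₂, hne⟩ := one_lt_card.1 hPv2
  obtain ⟨j₃, hj₃, hj₃1, hj₃2⟩ : ∃ j₃ ∈ A, j₃ ≠ j₁ ∧ j₃ ≠ j₂ := by
    have hsub : ({j₁, j₂} : Finset (Fin m)) ⊆ A := by
      intro j hj
      rw [mem_insert, mem_singleton] at hj
      rcases hj with rfl | rfl
      · exact hPv hj₁
      · exact hPv hj₂
    have hlt : ({j₁, j₂} : Finset (Fin m)).card < A.card := by rw [card_pair hne]; omega
    obtain ⟨j₃, hj₃, hj₃n⟩ := exists_mem_notMem_of_card_lt_card hlt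
    rw [mem_insert, mem_singleton, not_or] at hj₃n
    exact ⟨j₃, hj₃, hj₃n.1, hj₃n.2⟩
  exact ⟨j₁, hPv hj₁, j₂, hPv hj₂, j₃, hj₃, hne, hj₃1.symm, hj₃2.symm, hpriv j₁ hj₁, hpriv j₂ hj₂⟩

end Summit.PneNP.PneNP.Theorems.PstarGateUnitCycleBudget
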